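import Summits.QuantumAdvantage.QuantumAdvantage.Theorems.CubicForrelationNearExactIsExactCubicFormBalanced

/-!
# Crux `CubicForrelation.NearExactIsExact` (stmt-QuantumAdvantage-14043) — E1280-even, R4 branch: finite facts about `Z₁₀` used by the
  descendants `x₁q₄` (`HL 2`) and `T` (`HL 1`)

Certificate seat `b2b-cforr-cert` (gen 43).  HONEST FRAMING: kernel-checked elementary lemmas (standard axioms).  `Z₁₀ = {v ∈ 𝔽₂⁴ :
v₀v₁ = v₂v₃}` indexes the ten cells of the adapted R4 frame that enter the weight identity `#κ = 6·2⁷ + 2·Σ_{Z₁₀} #f_v`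
(…CubicFormR4Cells).  This file: the budget of descendant `x₁q₄` (`tq4_budget`: cells `≥ 24`, `Σ ≤ 255` ⇒ at most one cell of `Z₁₀`
weighs `≥ 32`); affine functions vanishing on `Z₁₀` minus a point vanish (`tq4_affine_core`, `tq4_affine`); a function on `𝔽₂⁴` with
base-point free second differences that vanishes on `Z₁₀` has polar form proportional to that of `v₀v₁ ⊕ v₂v₃` (`tq4_polar`,
`tq4_polar_table`) — the kernel of evaluation `RM(2,4) → 𝔽₂^{Z₁₀}` is spanned by `v₀v₁ ⊕ v₂v₃`.  Both descendants turn the last fact into a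
radical vector of the cubic form (`tpr_radical_obstruction`).  Nothing about `θ₁₂`; NOT summit progress.

References: this seat lineage (g37 R4-PARTNER §1/§6, g39 HANDPROOFS §2.1).  Axioms: the standard three.
-/

set_option linter.dupNamespace false -- D-0017: single-problem summit ⇒ `QuantumAdvantage.QuantumAdvantage` by design

namespace Summit.QuantumAdvantage.QuantumAdvantage.Theorems.CubicForrelation.NearExactIsExact

open Finset
open Literature.Computability.QuantumComplexity
open Literature.Computability.QuantumComplexity.BuzetChailloux (bxor zeroVec bxor_comm bxor_self bxor_zeroVec zeroVec_bxor
  bxor_bxor_cancel_left)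


/-- **At most one non-exact cell** (the budget of descendant `x₁q₄`).  If `w : 𝔽₂⁴ → ℕ` is `≥ 24` everywhere and its sum over the ten
cells of `Z₁₀` is `≤ 255`, then two distinct cells of `Z₁₀` cannot both weigh `≥ 32` (`8·24 + 2·32 = 256`). [this work] -/
theorem tq4_budget (w : (Fin 4 → Bool) → ℕ) (h24 : ∀ v, 24 ≤ w v)
    (hS : w ![false, false, false, false] + w ![false, false, false, true] + w ![false, false, true, false] + w ![false, true, false, false] +
      w ![false, true, false, true] + w ![false, true, true, false] + w ![true, false, false, false] + w ![true, false, false, true] +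
      w ![true, false, true, false] + w ![true, true, true, true] ≤ 255)
    (p v : Fin 4 → Bool) (hp : ((p 0 && p 1) ^^ (p 2 && p 3)) = false) (hv : ((v 0 && v 1) ^^ (v 2 && v 3)) = false) (hpv : p ≠ v)
    (h32p : 32 ≤ w p) (h32v : 32 ≤ w v) : False := by
  have ep : p = ![p 0, p 1, p 2, p 3] := by funext i; fin_cases i <;> rfl
  have ev : v = ![v 0, v 1, v 2, v 3] := by funext i; fin_cases i <;> rfl
  rw [ep] at h32p hpv; rw [ev] at h32v hpv
  have a0 := h24 ![false, false, false, false]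
  have a1 := h24 ![false, false, false, true]
  have a2 := h24 ![false, false, true, false]
  have a3 := h24 ![false, true, false, false]
  have a4 := h24 ![false, true, false, true]
  have a5 := h24 ![false, true, true, false]
  have a6 := h24 ![true, false, false, false]
  have a7 := h24 ![true, false, false, true]
  have a8 := h24 ![true, false, true, false]
  have a9 := h24 ![true, true, true, true]
  revert hp hv hpv h32p h32v
  generalize p 0 = p0; generalize p 1 = p1; generalize p 2 = p2; generalize p 3 = p3
  generalize v 0 = v0; generalize v 1 = v1; generalize v 2 = v2; generalize v 3 = v3
  intro hp hv hpv h32p h32v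
  cases p0 <;> cases p1 <;> cases p2 <;> cases p3 <;> cases v0 <;> cases v1 <;> cases v2 <;> cases v3 <;>
    first | exact absurd hp (by decide) | exact absurd hv (by decide) | exact absurd rfl hpv | omega

set_option synthInstance.maxSize 8192 in
set_option synthInstance.maxHeartbeats 200000 in
/-- **Affine functions vanishing on `Z₁₀` minus a point vanish** (every `9`-subset of `Z₁₀` affinely spans `𝔽₂⁴`), in the xor-expanded
format `a ⊕ v₀·a₀ ⊕ v₁·a₁ ⊕ v₂·a₂ ⊕ v₃·a₃` delivered by `tc5_second_rho` (explicit coefficients). [this work] -/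
theorem tq4_affine_core (p : Fin 4 → Bool) (a a0 a1 a2 a3 : Bool)
    (hz : ∀ v : Fin 4 → Bool, ((v 0 && v 1) ^^ (v 2 && v 3)) = false → v ≠ p →
      ((((a ^^ (v 0 && a0)) ^^ (v 1 && a1)) ^^ (v 2 && a2)) ^^ (v 3 && a3)) = false) :
    a = false ∧ a0 = false ∧ a1 = false ∧ a2 = false ∧ a3 = false := by
  have ep : p = ![p 0, p 1, p 2, p 3] := by funext i; fin_cases i <;> rfl
  have H : ∀ v0 v1 v2 v3 : Bool, ((v0 && v1) ^^ (v2 && v3)) = false → (![v0, v1, v2, v3] : Fin 4 → Bool) ≠ ![p 0, p 1, p 2, p 3] →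
      ((((a ^^ (v0 && a0)) ^^ (v1 && a1)) ^^ (v2 && a2)) ^^ (v3 && a3)) = false := by
    intro v0 v1 v2 v3 hq hne
    have e := hz ![v0, v1, v2, v3] hq (by rw [← ep] at hne; exact hne)
    exact e
  revert H
  generalize p 0 = p0; generalize p 1 = p1; generalize p 2 = p2; generalize p 3 = p3
  intro H
  have hne : ∀ v0 v1 v2 v3 : Bool, (¬ (v0 = p0 ∧ v1 = p1 ∧ v2 = p2 ∧ v3 = p3)) →
      (![v0, v1, v2, v3] : Fin 4 → Bool) ≠ ![p0, p1, p2, p3] := by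
    intro v0 v1 v2 v3 hn heq
    apply hn
    have e0 := congrFun heq 0; have e1 := congrFun heq 1; have e2 := congrFun heq 2; have e3 := congrFun heq 3
    simp only [Matrix.cons_val_zero, Matrix.cons_val_one] at e0 e1 e2 e3
    exact ⟨e0, e1, e2, e3⟩
  have H' : ∀ v0 v1 v2 v3 : Bool, ((v0 && v1) ^^ (v2 && v3)) = false → (¬ (v0 = p0 ∧ v1 = p1 ∧ v2 = p2 ∧ v3 = p3)) →
      ((((a ^^ (v0 && a0)) ^^ (v1 && a1)) ^^ (v2 && a2)) ^^ (v3 && a3)) = false :=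
    fun v0 v1 v2 v3 hq hn => H v0 v1 v2 v3 hq (hne v0 v1 v2 v3 hn)
  clear H hne hz ep p
  revert a a0 a1 a2 a3 H'
  cases p0 <;> cases p1 <;> cases p2 <;> cases p3 <;> decide

/-- **Affine functions vanishing on `Z₁₀` minus a point vanish** — coefficient-vector form of `tq4_affine_core`. [this work] -/
theorem tq4_affine (p : Fin 4 → Bool) (a : Bool) (av : Fin 4 → Bool)
    (hz : ∀ v : Fin 4 → Bool, ((v 0 && v 1) ^^ (v 2 && v 3)) = false → v ≠ p →
      ((((a ^^ (v 0 && av 0)) ^^ (v 1 && av 1)) ^^ (v 2 && av 2)) ^^ (v 3 && av 3)) = false) :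
    a = false ∧ ∀ t, av t = false := by
  obtain ⟨h, h0, h1, h2, h3⟩ := tq4_affine_core p a (av 0) (av 1) (av 2) (av 3) hz
  exact ⟨h, fun t => match t with | 0 => h0 | 1 => h1 | 2 => h2 | 3 => h3⟩

/-- **Functions with constant second differences vanishing on `Z₁₀`.**  If `q : 𝔽₂⁴ → 𝔽₂` has second differences `B(s,t)` (independent
of the base point) and vanishes on `Z₁₀ = {v₀v₁ = v₂v₃}`, then `B(e₀,e₁) = B(e₂,e₃)` and `B(eᵢ,eⱼ) = 0` for the four other pairs — the polar
form of `q` is a multiple of that of `v₀v₁ ⊕ v₂v₃` (the kernel of evaluation `RM(2,4) → 𝔽₂^{Z₁₀}` is spanned by `v₀v₁ ⊕ v₂v₃`). [this work] -/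
theorem tq4_polar (q : (Fin 4 → Bool) → Bool) (B : (Fin 4 → Bool) → (Fin 4 → Bool) → Bool)
    (hB : ∀ s t x, ((q x ^^ q (bxor x t)) ^^ (q (bxor x s) ^^ q (bxor (bxor x s) t))) = B s t)
    (hz : ∀ v : Fin 4 → Bool, ((v 0 && v 1) ^^ (v 2 && v 3)) = false → q v = false) :
    B (fun l => decide (l = 0)) (fun l => decide (l = 1)) = B (fun l => decide (l = 2)) (fun l => decide (l = 3)) ∧
    B (fun l => decide (l = 0)) (fun l => decide (l = 2)) = false ∧ B (fun l => decide (l = 0)) (fun l => decide (l = 3)) = false ∧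
    B (fun l => decide (l = 1)) (fun l => decide (l = 2)) = false ∧ B (fun l => decide (l = 1)) (fun l => decide (l = 3)) = false := by
  obtain ⟨hsymm, hadd, -, htr⟩ := tcb_form_basic q B hB
  have q0 : q zeroVec = false := hz zeroVec rfl
  have q1 : ∀ i : Fin 4, q (fun l => decide (l = i)) = false := fun i => hz _ (by fin_cases i <;> rfl)
  -- value on a sum of two unit vectors
  have q2 : ∀ i j : Fin 4, q (bxor (fun l => decide (l = i)) (fun l => decide (l = j))) = B (fun l => decide (l = i)) (fun l => decide (l = j)) := by
    intro i j
    rw [htr, q0, q1, q1]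
    simp
  have z02 := hz (bxor (fun l => decide (l = (0 : Fin 4))) (fun l => decide (l = 2))) (by decide)
  have z03 := hz (bxor (fun l => decide (l = (0 : Fin 4))) (fun l => decide (l = 3))) (by decide)
  have z12 := hz (bxor (fun l => decide (l = (1 : Fin 4))) (fun l => decide (l = 2))) (by decide)
  have z13 := hz (bxor (fun l => decide (l = (1 : Fin 4))) (fun l => decide (l = 3))) (by decide)
  rw [q2] at z02 z03 z12 z13
  refine ⟨?_, z02, z03, z12, z13⟩
  -- the point `1111 = (e₀ ⊕ e₁) ⊕ (e₂ ⊕ e₃)`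
  have hx : ∀ u t1 t2 : Fin 4 → Bool, B u (bxor t1 t2) = (B u t1 ^^ B u t2) := fun u t1 t2 => by
    rw [hsymm, hadd, hsymm t1, hsymm t2]
  have z1111 := hz (bxor (bxor (fun l => decide (l = (0 : Fin 4))) (fun l => decide (l = 1)))
    (bxor (fun l => decide (l = (2 : Fin 4))) (fun l => decide (l = 3)))) (by decide)
  rw [htr, q2, q2, q0, hadd, hx, hx, z02, z03, z12, z13] at z1111
  revert z1111
  cases B (fun l => decide (l = 0)) (fun l => decide (l = 1)) <;> cases B (fun l => decide (l = 2)) (fun l => decide (l = 3)) <;> decide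

/-- **The polar form on unit vectors, tabulated** (for the radical computation of …CubicFormR4LevelTwo): under the hypotheses of
`tq4_polar`, for all coordinates `a, c`: `[B(e_a,e_c)] + [B(e₀,e₁)]·([{a,c} = {0,1}] + [{a,c} = {2,3}]) = 0` in `𝔽₂` — i.e. the polar form
of `q` is `B(e₀,e₁)` times that of `v₀v₁ ⊕ v₂v₃`. [this work] -/
theorem tq4_polar_table (q : (Fin 4 → Bool) → Bool) (B : (Fin 4 → Bool) → (Fin 4 → Bool) → Bool)
    (hB : ∀ s t x, ((q x ^^ q (bxor x t)) ^^ (q (bxor x s) ^^ q (bxor (bxor x s) t))) = B s t)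
    (hz : ∀ v : Fin 4 → Bool, ((v 0 && v 1) ^^ (v 2 && v 3)) = false → q v = false) :
    ∀ a c : Fin 4, (if B (fun l => decide (l = a)) (fun l => decide (l = c)) = true then (1 : ZMod 2) else 0) +
      (if B (fun l => decide (l = 0)) (fun l => decide (l = 1)) = true then (1 : ZMod 2) else 0) *
        ((if (a = 0 ∧ c = 1) ∨ (a = 1 ∧ c = 0) then (1 : ZMod 2) else 0) + (if (a = 2 ∧ c = 3) ∨ (a = 3 ∧ c = 2) then (1 : ZMod 2) else 0)) = 0 := by
  obtain ⟨P1, P2, P3, P4, P5⟩ := tq4_polar q B hB hz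
  obtain ⟨hsymm, -, halt, -⟩ := tcb_form_basic q B hB
  intro a c
  by_cases h01 : (a = 0 ∧ c = 1) ∨ (a = 1 ∧ c = 0)
  · rcases h01 with ⟨rfl, rfl⟩ | ⟨rfl, rfl⟩
    · generalize B (fun l => decide (l = (0 : Fin 4))) (fun l => decide (l = 1)) = x
      revert x; decide
    · rw [hsymm (fun l => decide (l = (1 : Fin 4))) (fun l => decide (l = 0))]
      generalize B (fun l => decide (l = (0 : Fin 4))) (fun l => decide (l = 1)) = x
      revert x; decide
  by_cases h23 : (a = 2 ∧ c = 3) ∨ (a = 3 ∧ c = 2)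
  · rcases h23 with ⟨rfl, rfl⟩ | ⟨rfl, rfl⟩
    · rw [← P1]
      generalize B (fun l => decide (l = (0 : Fin 4))) (fun l => decide (l = 1)) = x
      revert x; decide
    · rw [hsymm (fun l => decide (l = (3 : Fin 4))) (fun l => decide (l = 2)), ← P1]
      generalize B (fun l => decide (l = (0 : Fin 4))) (fun l => decide (l = 1)) = x
      revert x; decide
  have hv : B (fun l => decide (l = a)) (fun l => decide (l = c)) = false := by
    by_cases hac : a = c
    · subst hac; exact halt _
    · fin_cases a <;> fin_cases c <;>
        first
        | exact absurd rfl hac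
        | exact absurd (Or.inl ⟨rfl, rfl⟩) h01
        | exact absurd (Or.inr ⟨rfl, rfl⟩) h01
        | exact absurd (Or.inl ⟨rfl, rfl⟩) h23
        | exact absurd (Or.inr ⟨rfl, rfl⟩) h23
        | exact P2
        | exact P3
        | exact P4
        | exact P5
        | exact (hsymm _ _).trans P2
        | exact (hsymm _ _).trans P3
        | exact (hsymm _ _).trans P4
        | exact (hsymm _ _).trans P5
  rw [hv, if_neg h01, if_neg h23]
  simp

end Summit.QuantumAdvantage.QuantumAdvantage.Theorems.CubicForrelation.NearExactIsExact
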